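import Literature.NumberTheory.LFunctions.RudnickSarnakNSliceChange
import HarnessLib

/-!
# Rudnick–Sarnak `n`-level correlations for `ζ`, XV: the change of variables of a cell

Sibling file of `Literature/NumberTheory/LFunctions/RudnickSarnak.lean` (toward
`Literature.NumberTheory.LFunctions.rudnick_sarnak_unrestricted` at every level). For a pattern —
a set `D` of density slots, a set `P ⊆ Dᶜ` of negative Dirichlet-polynomial slots and a matching
`β : P ≃ Q`, `Q = Dᶜ ∖ P` — we set up the change of variables of Rudnick–Sarnak 1996,
(3.69)–(3.73) on the slice `ξ_0 = −Σ_{j≥1} ξ_j`: the matched pairs `{p, βp}` not containing the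
dependent slot `0` are sheared (`η_{p} ↦ −η_p − η_{βp}`, `RudnickSarnakN.pairShear`), and the
density coordinates and the sheared pair coordinates are dilated by `1/L`. In the new variables
(`RudnickSarnakN.xiT`) every coordinate of the slice point is an explicit affine-linear
expression (`RudnickSarnakN.xiT_succ_of_mem_D`, `…_of_mem_A`, `…_of_not_mem`, `RudnickSarnakN.xiT_zero`),
the dependent coordinate being `ξ_0 = −λ(η)/L − z(η)` with the linear form
`λ = Σ_{D} η − Σ_{A} η` of the dilated coordinates and `z` the coordinate of the partner of slot
`0` (if slot `0` is matched), and `∫ F(ξ(η)) dη = L^{−|U|} ∫ F(ξ_T(η)) dη`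
(`RudnickSarnakN.integral_slicePt_eq_integral_xiT`) with `|U| = |D| + |P| − 1`
(`RudnickSarnakN.card_Uidx`).

## References

* Z. Rudnick, P. Sarnak, *Zeros of principal `L`-functions and random matrix theory*, Duke Math.
  J. 81 (1996), 269–322, (3.69)–(3.73).
-/

noncomputable section

open Complex Filter Set MeasureTheory Finset
open scoped Real Topology

namespace Literature.NumberTheory.LFunctions

namespace RudnickSarnakN

variable {k : ℕ}

section Pattern

variable (D P : Finset (Fin (k + 1))) (β : ↥P ≃ ↥((Finset.univ \ D) \ P))

/-! ## The matching as a function on slots, and the index classes -/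

/-- The matching extended to all slots (identity off `P`). [folklore] -/
def betaF (j : Fin (k + 1)) : Fin (k + 1) :=
  if h : j ∈ P then ((β ⟨j, h⟩ : ↥((Finset.univ \ D) \ P)) : Fin (k + 1)) else j

/-- `βf p ∈ Q` for `p ∈ P`. [folklore] -/
theorem betaF_mem {j : Fin (k + 1)} (hj : j ∈ P) : betaF D P β j ∈ (Finset.univ \ D) \ P := by
  unfold betaF; rw [dif_pos hj]; exact (β ⟨j, hj⟩).2

/-- `βf` is injective on `P`. [folklore] -/
theorem betaF_injOn : Set.InjOn (betaF D P β) P := by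
  intro a ha b hb h
  unfold betaF at h
  rw [dif_pos (Finset.mem_coe.1 ha), dif_pos (Finset.mem_coe.1 hb)] at h
  have := β.injective (Subtype.ext h)
  exact congrArg Subtype.val this

/-- Every `q ∈ Q` is `βf p` for a unique `p ∈ P`. [folklore] -/
theorem exists_betaF_eq {q : Fin (k + 1)} (hq : q ∈ (Finset.univ \ D) \ P) : ∃ p, p ∈ P ∧ betaF D P β p = q := by
  refine ⟨(β.symm ⟨q, hq⟩ : P), (β.symm ⟨q, hq⟩).2, ?_⟩
  unfold betaF
  rw [dif_pos (β.symm ⟨q, hq⟩).2]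
  simp

/-- The density indices: `i` with slot `i+1 ∈ D`. [folklore] -/
def Didx : Finset (Fin k) := Finset.univ.filter fun i ↦ i.succ ∈ D

/-- The sheared indices: `i` with slot `i+1 = p ∈ P` and `βp ≠ 0`. [folklore] -/
def Aidx : Finset (Fin k) := Finset.univ.filter fun i ↦ i.succ ∈ P ∧ betaF D P β i.succ ≠ 0

/-- The partner of a sheared index: the index of the slot `β(i+1)`. [folklore] -/
def prt (i : Fin k) : Fin k :=
  if h : betaF D P β i.succ = 0 then i else (betaF D P β i.succ).pred h

/-- `(prt i) + 1 = βf (i+1)` on `A`. [folklore] -/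
theorem prt_succ {i : Fin k} (hi : i ∈ Aidx D P β) : (prt D P β i).succ = betaF D P β i.succ := by
  unfold prt
  rw [Aidx, Finset.mem_filter] at hi
  rw [dif_neg hi.2.2, Fin.succ_pred]

/-- The partner indices `B = prt(A)`. [folklore] -/
def Bidx : Finset (Fin k) := (Aidx D P β).image (prt D P β)

/-- The remaining indices (the partner of slot `0`, if any). [folklore] -/
def Zidx : Finset (Fin k) := Finset.univ \ (Didx D ∪ Aidx D P β ∪ Bidx D P β)

/-- The dilated indices `U = Dη ∪ A`. [folklore] -/
def Uidx : Finset (Fin k) := Didx D ∪ Aidx D P β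

variable {D P β}
variable (hP : P ⊆ Finset.univ \ D)
include hP

/-- `P` and `D` are disjoint. [folklore] -/
theorem disjoint_D_P : Disjoint D P := Finset.disjoint_of_subset_right hP Finset.disjoint_sdiff

omit hP in
/-- Partner slots lie in `Q`. [folklore] -/
theorem prt_succ_mem {i : Fin k} (hi : i ∈ Aidx D P β) : (prt D P β i).succ ∈ (Finset.univ \ D) \ P := by
  rw [prt_succ D P β hi]
  rw [Aidx, Finset.mem_filter] at hi
  exact betaF_mem D P β hi.2.1

omit hP in
/-- Partners are not sheared. [folklore] -/
theorem prt_not_mem_Aidx {i : Fin k} (hi : i ∈ Aidx D P β) : prt D P β i ∉ Aidx D P β := by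
  intro h
  have h1 := prt_succ_mem hi
  rw [Aidx, Finset.mem_filter] at h
  exact (Finset.mem_sdiff.1 h1).2 h.2.1

omit hP in
/-- Partners are not density indices. [folklore] -/
theorem prt_not_mem_Didx {i : Fin k} (hi : i ∈ Aidx D P β) : prt D P β i ∉ Didx D := by
  intro h
  have h1 := prt_succ_mem hi
  rw [Didx, Finset.mem_filter] at h
  exact (Finset.mem_sdiff.1 (Finset.mem_sdiff.1 h1).1).2 h.2

omit hP in
/-- Partners are not dilated. [folklore] -/
theorem prt_not_mem_Uidx {i : Fin k} (hi : i ∈ Aidx D P β) : prt D P β i ∉ Uidx D P β := by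
  rw [Uidx, Finset.mem_union, not_or]; exact ⟨prt_not_mem_Didx hi, prt_not_mem_Aidx hi⟩

omit hP in
/-- `prt` is injective on `A`. [folklore] -/
theorem prt_injOn : Set.InjOn (prt D P β) (Aidx D P β) := by
  intro a ha b hb h
  have ha' := ha; have hb' := hb
  rw [Finset.mem_coe, Aidx, Finset.mem_filter] at ha' hb'
  have h1 : betaF D P β a.succ = betaF D P β b.succ := by
    rw [← prt_succ D P β ha, ← prt_succ D P β hb, h]
  have := betaF_injOn D P β (Finset.mem_coe.2 ha'.2.1) (Finset.mem_coe.2 hb'.2.1) h1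
  exact Fin.succ_injective _ this

/-- `D`-indices and `A`-indices are disjoint. [folklore] -/
theorem disjoint_Didx_Aidx : Disjoint (Didx D) (Aidx D P β) := by
  rw [Finset.disjoint_left]
  intro i hD hA
  rw [Didx, Finset.mem_filter] at hD
  rw [Aidx, Finset.mem_filter] at hA
  exact Finset.disjoint_left.1 (disjoint_D_P hP) hD.2 hA.2.1

omit hP in
/-- `B` is disjoint from `U`. [folklore] -/
theorem disjoint_Uidx_Bidx : Disjoint (Uidx D P β) (Bidx D P β) := by
  rw [Finset.disjoint_right]
  intro i hi
  rw [Bidx, Finset.mem_image] at hi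
  obtain ⟨a, ha, rfl⟩ := hi
  exact prt_not_mem_Uidx ha

/-- **The index classes partition `Fin k`.** [folklore] -/
theorem sum_eq_sum_classes {M : Type*} [AddCommMonoid M] (f : Fin k → M) :
    ∑ i, f i = ∑ i ∈ Didx D, f i + ∑ i ∈ Aidx D P β, f i + ∑ i ∈ Aidx D P β, f (prt D P β i) + ∑ i ∈ Zidx D P β, f i := by
  have hB : ∑ i ∈ Bidx D P β, f i = ∑ i ∈ Aidx D P β, f (prt D P β i) := by
    rw [Bidx, Finset.sum_image fun a ha b hb h ↦ prt_injOn ha hb h]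
  rw [← hB]
  have h1 : Disjoint (Didx D ∪ Aidx D P β) (Bidx D P β) := disjoint_Uidx_Bidx
  have h2 : Disjoint (Didx D ∪ Aidx D P β ∪ Bidx D P β) (Zidx D P β) := by rw [Zidx]; exact Finset.disjoint_sdiff
  rw [← Finset.sum_union (disjoint_Didx_Aidx hP), ← Finset.sum_union h1, ← Finset.sum_union h2]
  congr 1
  rw [Zidx, Finset.union_sdiff_of_subset (Finset.subset_univ _)]

omit hP in
/-- Membership in `Z`: neither a density index, nor sheared, nor a partner. [folklore] -/
theorem mem_Zidx_iff (i : Fin k) : i ∈ Zidx D P β ↔ i ∉ Didx D ∧ i ∉ Aidx D P β ∧ i ∉ Bidx D P β := by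
  rw [Zidx]; simp [not_or]

omit hP in
/-- `Z`-indices are not dilated. [folklore] -/
theorem not_mem_Uidx_of_mem_Zidx {i : Fin k} (hi : i ∈ Zidx D P β) : i ∉ Uidx D P β := by
  rw [mem_Zidx_iff] at hi
  rw [Uidx, Finset.mem_union, not_or]; exact ⟨hi.1, hi.2.1⟩

/-! ## The change of variables -/

variable (D P β)

/-- The dilation vector: `L⁻¹` on `U`, `1` elsewhere. [folklore] -/
def cvec (L : ℝ) (i : Fin k) : ℝ := if i ∈ Uidx D P β then L⁻¹ else 1

/-- **The new slice point** `ξ_T(η) = ξ(shear(c · η))`. [cite: RudnickSarnak1996, (3.69)–(3.73)] -/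
def xiT (L : ℝ) (η : Fin k → ℝ) : Fin (k + 1) → ℝ :=
  slicePt (pairShear (Aidx D P β) (prt D P β) (fun i ↦ cvec D P β L i * η i))

/-- The linear form of the dilated coordinates: `λ(η) = Σ_{Dη} η_i − Σ_A η_i`. [folklore] -/
def lam (η : Fin k → ℝ) : ℝ := ∑ i ∈ Didx D, η i - ∑ i ∈ Aidx D P β, η i

/-- The partner coordinate of slot `0`: `z(η) = Σ_{Z} η_i` (zero or one term). [folklore] -/
def zcoord (η : Fin k → ℝ) : ℝ := ∑ i ∈ Zidx D P β, η i

variable {D P β}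

omit hP in
/-- **The change of variables on the slice**: for `L > 0` and any `F`,
`∫ F(ξ(η)) dη = L^{−|U|} ∫ F(ξ_T(η)) dη`. [cite: RudnickSarnak1996, (3.69)–(3.73)] -/
theorem integral_slicePt_eq_integral_xiT {E : Type*} [NormedAddCommGroup E] [NormedSpace ℝ E]
    {L : ℝ} (hL : 0 < L) (F : (Fin (k + 1) → ℝ) → E) :
    ∫ η : Fin k → ℝ, F (slicePt η) = (L ^ (Uidx D P β).card)⁻¹ • ∫ η : Fin k → ℝ, F (xiT D P β L η) := by
  have h1 : ∫ η : Fin k → ℝ, F (slicePt η) = ∫ η : Fin k → ℝ, F (slicePt (pairShear (Aidx D P β) (prt D P β) η)) :=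
    (integral_comp_pairShear (Aidx D P β) (prt D P β) (fun a ha ↦ prt_not_mem_Aidx ha)
      (fun η ↦ F (slicePt η))).symm
  have hc : ∀ i, cvec D P β L i ≠ 0 := fun i ↦ by
    unfold cvec; split_ifs
    · exact inv_ne_zero hL.ne'
    · exact one_ne_zero
  have h2 := integral_comp_diag (cvec D P β L) hc (fun η ↦ F (slicePt (pairShear (Aidx D P β) (prt D P β) η)))
  have hpos : ∀ i, 0 < cvec D P β L i := fun i ↦ by
    unfold cvec; split_ifs
    · positivity
    · norm_num
  have hprod : ∏ i, |cvec D P β L i| = (L ^ (Uidx D P β).card)⁻¹ := by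
    rw [Finset.prod_congr rfl fun i _ ↦ abs_of_pos (hpos i)]
    unfold cvec
    rw [Finset.prod_ite, Finset.prod_const_one, mul_one, Finset.prod_const, Finset.filter_mem_eq_inter,
      Finset.univ_inter, inv_pow]
  rw [hprod, inv_inv] at h2
  rw [h1]
  have h3 : ∫ η : Fin k → ℝ, F (slicePt (pairShear (Aidx D P β) (prt D P β) η)) =
      (L ^ (Uidx D P β).card)⁻¹ • ∫ η : Fin k → ℝ, F (slicePt (pairShear (Aidx D P β) (prt D P β) fun i ↦ cvec D P β L i * η i)) := by
    rw [h2, smul_smul, inv_mul_cancel₀ (pow_ne_zero _ hL.ne'), one_smul]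
  rw [h3]
  rfl

omit hP in
/-- The free coordinates: for `i ∈ A`, `ξ_{i+1} = −η_i/L − η_{prt i}`. [cite: RudnickSarnak1996, (3.69)] -/
theorem xiT_succ_of_mem_A {L : ℝ} (η : Fin k → ℝ) {i : Fin k} (hi : i ∈ Aidx D P β) :
    xiT D P β L η i.succ = -(L⁻¹ * η i) - η (prt D P β i) := by
  unfold xiT slicePt
  rw [Fin.cons_succ, pairShear_apply, if_pos hi]
  unfold cvec
  rw [if_pos (show i ∈ Uidx D P β from Finset.mem_union_right _ hi), if_neg (prt_not_mem_Uidx hi)]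
  ring

omit hP in
/-- The free coordinates off `A`: `ξ_{i+1} = c_i η_i`. [folklore] -/
theorem xiT_succ_of_not_mem_A {L : ℝ} (η : Fin k → ℝ) {i : Fin k} (hi : i ∉ Aidx D P β) :
    xiT D P β L η i.succ = cvec D P β L i * η i := by
  unfold xiT slicePt
  rw [Fin.cons_succ, pairShear_apply, if_neg hi]

/-- For `i ∈ Dη`: `ξ_{i+1} = η_i/L`. [cite: RudnickSarnak1996, (3.69)] -/
theorem xiT_succ_of_mem_D {L : ℝ} (η : Fin k → ℝ) {i : Fin k} (hi : i ∈ Didx D) :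
    xiT D P β L η i.succ = L⁻¹ * η i := by
  have hA : i ∉ Aidx D P β := Finset.disjoint_left.1 (disjoint_Didx_Aidx (β := β) hP) hi
  rw [xiT_succ_of_not_mem_A η hA]
  unfold cvec; rw [if_pos (show i ∈ Uidx D P β from Finset.mem_union_left _ hi)]

omit hP in
/-- For a partner `i = prt a`: `ξ_{i+1} = η_i`. [folklore] -/
theorem xiT_succ_prt {L : ℝ} (η : Fin k → ℝ) {a : Fin k} (ha : a ∈ Aidx D P β) :
    xiT D P β L η (prt D P β a).succ = η (prt D P β a) := by
  rw [xiT_succ_of_not_mem_A η (prt_not_mem_Aidx ha)]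
  unfold cvec; rw [if_neg (prt_not_mem_Uidx ha), one_mul]

omit hP in
/-- For `i ∈ Z`: `ξ_{i+1} = η_i`. [folklore] -/
theorem xiT_succ_of_mem_Z {L : ℝ} (η : Fin k → ℝ) {i : Fin k} (hi : i ∈ Zidx D P β) :
    xiT D P β L η i.succ = η i := by
  have h := (mem_Zidx_iff i).1 hi
  rw [xiT_succ_of_not_mem_A η h.2.1]
  unfold cvec; rw [if_neg (not_mem_Uidx_of_mem_Zidx hi), one_mul]

/-- **The dependent coordinate**: `ξ_0 = −λ(η)/L − z(η)`. [cite: RudnickSarnak1996, (3.72)] -/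
theorem xiT_zero {L : ℝ} (η : Fin k → ℝ) : xiT D P β L η 0 = -(L⁻¹ * lam D P β η) - zcoord D P β η := by
  have h0 : xiT D P β L η 0 = -∑ i : Fin k, xiT D P β L η i.succ := by
    unfold xiT slicePt
    rw [Fin.cons_zero]
    congr 1
  rw [h0, sum_eq_sum_classes hP]
  rw [Finset.sum_congr rfl fun i hi ↦ xiT_succ_of_mem_D hP η hi,
    Finset.sum_congr rfl fun i hi ↦ xiT_succ_of_mem_A η hi,
    Finset.sum_congr rfl fun i hi ↦ xiT_succ_prt η hi,
    Finset.sum_congr rfl fun i hi ↦ xiT_succ_of_mem_Z η hi]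
  unfold lam zcoord
  rw [← Finset.mul_sum, Finset.sum_sub_distrib, Finset.sum_neg_distrib, ← Finset.mul_sum]
  ring

/-! ## Cardinalities -/

omit hP in
/-- `|Dη| = |D ∖ {0}|`. [folklore] -/
theorem card_Didx : (Didx D).card = (D.erase 0).card := by
  refine Finset.card_bij (fun i _ ↦ i.succ) (fun i hi ↦ ?_) (fun i _ j _ h ↦ Fin.succ_injective _ h) (fun j hj ↦ ?_)
  · rw [Didx, Finset.mem_filter] at hi
    exact Finset.mem_erase.2 ⟨Fin.succ_ne_zero _, hi.2⟩
  · rw [Finset.mem_erase] at hj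
    refine ⟨j.pred hj.1, ?_, Fin.succ_pred _ _⟩
    rw [Didx, Finset.mem_filter]
    exact ⟨Finset.mem_univ _, by rw [Fin.succ_pred]; exact hj.2⟩

omit hP in
/-- `|A| = |{p ∈ P : p ≠ 0, βp ≠ 0}|`. [folklore] -/
theorem card_Aidx : (Aidx D P β).card = (P.filter fun p ↦ p ≠ 0 ∧ betaF D P β p ≠ 0).card := by
  refine Finset.card_bij (fun i _ ↦ i.succ) (fun i hi ↦ ?_) (fun i _ j _ h ↦ Fin.succ_injective _ h) (fun j hj ↦ ?_)
  · rw [Aidx, Finset.mem_filter] at hi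
    exact Finset.mem_filter.2 ⟨hi.2.1, Fin.succ_ne_zero _, hi.2.2⟩
  · rw [Finset.mem_filter] at hj
    refine ⟨j.pred hj.2.1, ?_, Fin.succ_pred _ _⟩
    rw [Aidx, Finset.mem_filter]
    exact ⟨Finset.mem_univ _, by rw [Fin.succ_pred]; exact hj.1, by rw [Fin.succ_pred]; exact hj.2.2⟩

/-! ## Where is slot `0`? -/

/-- Slot `0` is in exactly one of `D`, `P`, `Q`. [folklore] -/
theorem zero_mem_cases : (0 ∈ D ∧ (0 : Fin (k + 1)) ∉ P ∧ (0 : Fin (k + 1)) ∉ (Finset.univ \ D) \ P) ∨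
    ((0 : Fin (k + 1)) ∉ D ∧ 0 ∈ P ∧ (0 : Fin (k + 1)) ∉ (Finset.univ \ D) \ P) ∨
    ((0 : Fin (k + 1)) ∉ D ∧ (0 : Fin (k + 1)) ∉ P ∧ 0 ∈ (Finset.univ \ D) \ P) := by
  by_cases hD : (0 : Fin (k + 1)) ∈ D
  · refine Or.inl ⟨hD, fun h ↦ ?_, fun h ↦ ?_⟩
    · exact Finset.disjoint_left.1 (disjoint_D_P hP) hD h
    · exact (Finset.mem_sdiff.1 (Finset.mem_sdiff.1 h).1).2 hD
  · by_cases hPm : (0 : Fin (k + 1)) ∈ P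
    · exact Or.inr (Or.inl ⟨hD, hPm, fun h ↦ (Finset.mem_sdiff.1 h).2 hPm⟩)
    · refine Or.inr (Or.inr ⟨hD, hPm, ?_⟩)
      simp [hD, hPm]

omit hP in
/-- If `0 ∈ D` then no matched slot is `0`: `βf p ≠ 0` and `p ≠ 0` on `P`. [folklore] -/
theorem betaF_ne_zero_of_zero_mem_D (h0 : (0 : Fin (k + 1)) ∈ D) {p : Fin (k + 1)} (hp : p ∈ P) : betaF D P β p ≠ 0 := by
  intro h
  have := betaF_mem D P β hp
  rw [h] at this
  exact (Finset.mem_sdiff.1 (Finset.mem_sdiff.1 this).1).2 h0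

omit hP in
/-- If `0 ∈ P` then `βf p ≠ 0` on `P`. [folklore] -/
theorem betaF_ne_zero_of_zero_mem_P (h0 : (0 : Fin (k + 1)) ∈ P) {p : Fin (k + 1)} (hp : p ∈ P) : betaF D P β p ≠ 0 := by
  intro h
  have := betaF_mem D P β hp
  rw [h] at this
  exact (Finset.mem_sdiff.1 this).2 h0

/-- **`|U| + 1 = |D| + |P|`.** [folklore] -/
theorem card_Uidx : (Uidx D P β).card + 1 = D.card + P.card := by
  rw [Uidx, Finset.card_union_of_disjoint (disjoint_Didx_Aidx hP), card_Didx, card_Aidx]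
  rcases zero_mem_cases hP with ⟨hD, hPn, -⟩ | ⟨hD, hPm, -⟩ | ⟨hD, hPn, hQ⟩
  · rw [Finset.card_erase_of_mem hD]
    have hf : P.filter (fun p ↦ p ≠ 0 ∧ betaF D P β p ≠ 0) = P := by
      refine Finset.filter_true_of_mem fun p hp ↦ ⟨fun h ↦ hPn (h ▸ hp), betaF_ne_zero_of_zero_mem_D hD hp⟩
    rw [hf]
    have := Finset.card_pos.2 ⟨0, hD⟩
    omega
  · rw [Finset.erase_eq_of_notMem hD]
    have hf : P.filter (fun p ↦ p ≠ 0 ∧ betaF D P β p ≠ 0) = P.erase 0 := by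
      ext p
      simp only [Finset.mem_filter, Finset.mem_erase]
      constructor
      · rintro ⟨hp, hne, -⟩; exact ⟨hne, hp⟩
      · rintro ⟨hne, hp⟩; exact ⟨hp, hne, betaF_ne_zero_of_zero_mem_P hPm hp⟩
    rw [hf, Finset.card_erase_of_mem hPm]
    have := Finset.card_pos.2 ⟨0, hPm⟩
    omega
  · rw [Finset.erase_eq_of_notMem hD]
    obtain ⟨p₀, hp₀, hb⟩ := exists_betaF_eq D P β hQ
    have hf : P.filter (fun p ↦ p ≠ 0 ∧ betaF D P β p ≠ 0) = P.erase p₀ := by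
      ext p
      simp only [Finset.mem_filter, Finset.mem_erase]
      constructor
      · rintro ⟨hp, -, hne⟩
        exact ⟨fun h ↦ hne (h ▸ hb), hp⟩
      · rintro ⟨hne, hp⟩
        refine ⟨hp, fun h ↦ hPn (h ▸ hp), fun h ↦ hne ?_⟩
        exact betaF_injOn D P β (Finset.mem_coe.2 hp) (Finset.mem_coe.2 hp₀) (h.trans hb.symm)
    rw [hf, Finset.card_erase_of_mem hp₀]
    have := Finset.card_pos.2 ⟨p₀, hp₀⟩
    omega

/-! ## The partner coordinate of slot `0` -/

omit hP in
/-- Description of `Z`: an index in `Z` is the partner slot of `0`. [folklore] -/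
theorem succ_of_mem_Zidx {i : Fin k} (hi : i ∈ Zidx D P β) :
    (i.succ ∈ P ∧ betaF D P β i.succ = 0) ∨ ((0 : Fin (k + 1)) ∈ P ∧ betaF D P β 0 = i.succ) := by
  rw [mem_Zidx_iff] at hi
  obtain ⟨hD, hA, hB⟩ := hi
  have hD' : i.succ ∉ D := fun h ↦ hD (by rw [Didx, Finset.mem_filter]; exact ⟨Finset.mem_univ _, h⟩)
  by_cases hPi : i.succ ∈ P
  · left
    refine ⟨hPi, ?_⟩
    by_contra h
    exact hA (by rw [Aidx, Finset.mem_filter]; exact ⟨Finset.mem_univ _, hPi, h⟩)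
  · right
    have hQ : i.succ ∈ (Finset.univ \ D) \ P := by simp [hD', hPi]
    obtain ⟨p, hp, hbp⟩ := exists_betaF_eq D P β hQ
    by_cases hp0 : p = 0
    · subst hp0; exact ⟨hp, hbp⟩
    · exfalso
      apply hB
      rw [Bidx, Finset.mem_image]
      have ha : p.pred hp0 ∈ Aidx D P β := by
        rw [Aidx, Finset.mem_filter, Fin.succ_pred]
        exact ⟨Finset.mem_univ _, hp, by rw [hbp]; exact Fin.succ_ne_zero _⟩
      refine ⟨p.pred hp0, ha, ?_⟩
      apply Fin.succ_injective
      rw [prt_succ D P β ha, Fin.succ_pred, hbp]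

/-- `Z = ∅` when `0 ∈ D`. [folklore] -/
theorem Zidx_eq_empty (h0 : (0 : Fin (k + 1)) ∈ D) : Zidx D P β = ∅ := by
  rcases zero_mem_cases hP with ⟨-, hPn, -⟩ | ⟨hD, -, -⟩ | ⟨hD, -, -⟩
  · ext i
    simp only [Finset.notMem_empty, iff_false]
    intro hi
    rcases succ_of_mem_Zidx hi with ⟨hPi, hb⟩ | ⟨hP0, -⟩
    · exact betaF_ne_zero_of_zero_mem_D h0 hPi hb
    · exact hPn hP0
  · exact absurd h0 hD
  · exact absurd h0 hD

omit hP in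
/-- `Z = {(βf 0) − 1}` when `0 ∈ P`. [folklore] -/
theorem Zidx_eq_of_zero_mem_P (h0 : (0 : Fin (k + 1)) ∈ P) :
    Zidx D P β = {(betaF D P β 0).pred (betaF_ne_zero_of_zero_mem_P h0 h0)} := by
  ext i
  simp only [Finset.mem_singleton]
  constructor
  · intro hi
    rcases succ_of_mem_Zidx hi with ⟨hPi, hb⟩ | ⟨-, hb⟩
    · exact absurd hb (betaF_ne_zero_of_zero_mem_P h0 hPi)
    · apply Fin.succ_injective; rw [Fin.succ_pred]; exact hb.symm
  · intro hi
    subst hi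
    rw [mem_Zidx_iff]
    have hQ := betaF_mem D P β h0
    rw [← Fin.succ_pred (betaF D P β 0) (betaF_ne_zero_of_zero_mem_P h0 h0)] at hQ
    refine ⟨fun h ↦ ?_, fun h ↦ ?_, fun h ↦ ?_⟩
    · rw [Didx, Finset.mem_filter] at h
      exact (Finset.mem_sdiff.1 (Finset.mem_sdiff.1 hQ).1).2 h.2
    · rw [Aidx, Finset.mem_filter] at h
      exact (Finset.mem_sdiff.1 hQ).2 h.2.1
    · rw [Bidx, Finset.mem_image] at h
      obtain ⟨a, ha, hpa⟩ := h
      have h1 := prt_succ D P β ha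
      rw [hpa, Fin.succ_pred] at h1
      rw [Aidx, Finset.mem_filter] at ha
      have := betaF_injOn D P β (Finset.mem_coe.2 h0) (Finset.mem_coe.2 ha.2.1) h1
      exact Fin.succ_ne_zero a this.symm

/-- `Z = {p₀ − 1}` when `βf p₀ = 0`. [folklore] -/
theorem Zidx_eq_of_betaF_eq_zero {p₀ : Fin (k + 1)} (hp₀ : p₀ ∈ P) (hb : betaF D P β p₀ = 0) (hne : p₀ ≠ 0) :
    Zidx D P β = {p₀.pred hne} := by
  have hP0 : (0 : Fin (k + 1)) ∉ P := fun h ↦ by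
    have := betaF_mem D P β hp₀; rw [hb] at this; exact (Finset.mem_sdiff.1 this).2 h
  ext i
  simp only [Finset.mem_singleton]
  constructor
  · intro hi
    rcases succ_of_mem_Zidx hi with ⟨hPi, hbi⟩ | ⟨h0, -⟩
    · have := betaF_injOn D P β (Finset.mem_coe.2 hPi) (Finset.mem_coe.2 hp₀) (hbi.trans hb.symm)
      apply Fin.succ_injective; rw [Fin.succ_pred]; exact this
    · exact absurd h0 hP0
  · intro hi
    subst hi
    rw [mem_Zidx_iff]
    refine ⟨fun h ↦ ?_, fun h ↦ ?_, fun h ↦ ?_⟩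
    · rw [Didx, Finset.mem_filter, Fin.succ_pred] at h
      exact Finset.disjoint_left.1 (disjoint_D_P hP) h.2 hp₀
    · rw [Aidx, Finset.mem_filter, Fin.succ_pred] at h
      exact h.2.2 hb
    · rw [Bidx, Finset.mem_image] at h
      obtain ⟨a, ha, hpa⟩ := h
      have h1 := prt_succ_mem (β := β) ha
      rw [hpa, Fin.succ_pred] at h1
      exact (Finset.mem_sdiff.1 h1).2 hp₀

/-- `z(η) = 0` when `0 ∈ D`. [folklore] -/
theorem zcoord_eq_zero (h0 : (0 : Fin (k + 1)) ∈ D) (η : Fin k → ℝ) : zcoord D P β η = 0 := by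
  unfold zcoord; rw [Zidx_eq_empty hP h0, Finset.sum_empty]

omit hP in
/-- `z(η) = η_{βf 0 − 1}` when `0 ∈ P`. [folklore] -/
theorem zcoord_eq_of_zero_mem_P (h0 : (0 : Fin (k + 1)) ∈ P) (η : Fin k → ℝ) :
    zcoord D P β η = η ((betaF D P β 0).pred (betaF_ne_zero_of_zero_mem_P h0 h0)) := by
  unfold zcoord; rw [Zidx_eq_of_zero_mem_P h0, Finset.sum_singleton]

/-- `z(η) = η_{p₀ − 1}` when `βf p₀ = 0`. [folklore] -/
theorem zcoord_eq_of_betaF_eq_zero {p₀ : Fin (k + 1)} (hp₀ : p₀ ∈ P) (hb : betaF D P β p₀ = 0) (hne : p₀ ≠ 0)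
    (η : Fin k → ℝ) : zcoord D P β η = η (p₀.pred hne) := by
  unfold zcoord; rw [Zidx_eq_of_betaF_eq_zero hP hp₀ hb hne, Finset.sum_singleton]

/-! ## Products over the matched pairs -/

omit hP in
/-- A product over `P` as a subtype, through the matching. [folklore] -/
theorem prod_subtype_P {M : Type*} [CommMonoid M] (G : Fin (k + 1) → Fin (k + 1) → M) :
    ∏ p : P, G p (β p) = ∏ p ∈ P, G p (betaF D P β p) := by
  rw [← Finset.prod_coe_sort P]
  refine Finset.prod_congr rfl fun p _ ↦ ?_
  unfold betaF
  rw [dif_pos p.2]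

omit hP in
/-- Splitting a product over `P` into the sheared pairs and the rest:
`Π_{p∈P} F p = (Π_{a∈A} F (a+1)) · Π_{p ∈ P, p = 0 ∨ βf p = 0} F p`. [folklore] -/
theorem prod_P_split {M : Type*} [CommMonoid M] (F : Fin (k + 1) → M) :
    ∏ p ∈ P, F p = (∏ a ∈ Aidx D P β, F a.succ) * ∏ p ∈ P.filter (fun p ↦ ¬ (p ≠ 0 ∧ betaF D P β p ≠ 0)), F p := by
  rw [← Finset.prod_filter_mul_prod_filter_not P (fun p ↦ p ≠ 0 ∧ betaF D P β p ≠ 0)]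
  congr 1
  symm
  refine Finset.prod_bij (fun a _ ↦ a.succ) (fun a ha ↦ ?_) (fun a _ b _ h ↦ Fin.succ_injective _ h) (fun p hp ↦ ?_) (fun _ _ ↦ rfl)
  · rw [Aidx, Finset.mem_filter] at ha
    exact Finset.mem_filter.2 ⟨ha.2.1, Fin.succ_ne_zero _, ha.2.2⟩
  · rw [Finset.mem_filter] at hp
    refine ⟨p.pred hp.2.1, ?_, Fin.succ_pred _ _⟩
    rw [Aidx, Finset.mem_filter]
    exact ⟨Finset.mem_univ _, by rw [Fin.succ_pred]; exact hp.1, by rw [Fin.succ_pred]; exact hp.2.2⟩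

/-- The special part of `P` is empty when `0 ∈ D`. [folklore] -/
theorem filter_special_eq_empty (h0 : (0 : Fin (k + 1)) ∈ D) :
    P.filter (fun p ↦ ¬ (p ≠ 0 ∧ betaF D P β p ≠ 0)) = ∅ := by
  rcases zero_mem_cases hP with ⟨-, hPn, -⟩ | ⟨hD, -, -⟩ | ⟨hD, -, -⟩
  · refine Finset.filter_false_of_mem fun p hp h ↦ ?_
    apply h
    exact ⟨fun h' ↦ hPn (h' ▸ hp), betaF_ne_zero_of_zero_mem_D h0 hp⟩
  · exact absurd h0 hD
  · exact absurd h0 hD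

omit hP in
/-- The special part of `P` is `{0}` when `0 ∈ P`. [folklore] -/
theorem filter_special_eq_of_zero_mem_P (h0 : (0 : Fin (k + 1)) ∈ P) :
    P.filter (fun p ↦ ¬ (p ≠ 0 ∧ betaF D P β p ≠ 0)) = {0} := by
  ext p
  simp only [Finset.mem_filter, Finset.mem_singleton, not_and_or, not_not]
  constructor
  · rintro ⟨hp, h | h⟩
    · exact h
    · exact absurd h (betaF_ne_zero_of_zero_mem_P h0 hp)
  · intro h; subst h; exact ⟨h0, Or.inl rfl⟩

omit hP in
/-- The special part of `P` is `{p₀}` when `βf p₀ = 0`. [folklore] -/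
theorem filter_special_eq_of_betaF_eq_zero {p₀ : Fin (k + 1)} (hp₀ : p₀ ∈ P) (hb : betaF D P β p₀ = 0) :
    P.filter (fun p ↦ ¬ (p ≠ 0 ∧ betaF D P β p ≠ 0)) = {p₀} := by
  have hP0 : (0 : Fin (k + 1)) ∉ P := fun h ↦ by
    have := betaF_mem D P β hp₀; rw [hb] at this; exact (Finset.mem_sdiff.1 this).2 h
  ext p
  simp only [Finset.mem_filter, Finset.mem_singleton, not_and_or, not_not]
  constructor
  · rintro ⟨hp, h | h⟩
    · exact absurd (h ▸ hp) hP0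
    · exact betaF_injOn D P β (Finset.mem_coe.2 hp) (Finset.mem_coe.2 hp₀) (h.trans hb.symm)
  · intro h; subst h; exact ⟨hp₀, Or.inr hb⟩

end Pattern

end RudnickSarnakN

end Literature.NumberTheory.LFunctions

end
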